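import Mathlib
import Summits.Ventures.PercRepro2.StepZeroOfAS3
import Summits.Ventures.PercRepro2.AS3Disjoint

/-!
# (AS3) when `B □ B` is principal  (seat mine-b, cell pub-perc-repro2; conjectures/MINE-B.md §12.4)

The level-refined Reimer statement `AS3 U A B` (StepZeroOfAS3.lean) is proved here whenever the
disjoint-occurrence event `B □ B` is generated by a single set `W₁ ∪ W₂` (two disjoint members
`W₁`, `W₂` of `B` such that every configuration with two disjoint `B`-witnesses contains both) —
e.g. `B` generated by a family of sets with exactly one disjoint pair.  This is the first case in which
the injection is not Reimer's alone: with `r(A,B) = #{A ∧ B(ρ)} − #{A □ B}` (Reimer's slack) and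
`g(A,B) = #{A(γ) ∧ B □ B(ρ)} − #{A □ B(γ) ∧ B(ρ)}`, (AS3) is `r ≥ g`, and here `g ≤ 0` by the
red-to-blue hand-over `γ ↦ γ ∪ W₁` (injective because `W₁` lies in the red side of every source).
-/

open Finset

namespace Summit.Ventures.PercRepro2

namespace StepZero

open ReimerCube

variable {E : Type*} [DecidableEq E]

open Classical in
/-- **(AS3) when `B □ B` is principal**: if `W₁`, `W₂` are disjoint members of `B` and every
configuration with two disjoint `B`-witnesses contains `W₁ ∪ W₂`, then `AS3 U A B` holds for every
increasing `A`, `B`. -/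
theorem AS3_of_dOcc_principal (U : Finset E) (A B : Finset E → Prop) (hA : Incr A) (hB : Incr B)
    (W₁ W₂ : Finset E) (h₁ : B W₁) (h₂ : B W₂) (hd : Disjoint W₁ W₂)
    (hgen : ∀ X ⊆ U, DOcc B B X → W₁ ∪ W₂ ⊆ X) : AS3 U A B := by
  unfold AS3
  -- Reimer
  have hR := reimer_increasing U A B hA hB
  -- split Reimer's left side at `B (U \ γ)` and its right side at `B □ B (U \ γ)`
  have s1 := Finset.card_filter_add_card_filter_not (fun γ => B (U \ γ))
    (s := U.powerset.filter (fun γ => DOcc A B γ))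
  have s2 := Finset.card_filter_add_card_filter_not (fun γ => DOcc B B (U \ γ))
    (s := U.powerset.filter (fun γ => A γ ∧ B (U \ γ)))
  -- the red-to-blue hand-over `γ ↦ γ ∪ W₁` injects the subtracted right part into the subtracted
  -- left part
  have hinj : ((U.powerset.filter (fun γ => A γ ∧ B (U \ γ))).filter
        (fun γ => DOcc B B (U \ γ))).card
      ≤ ((U.powerset.filter (fun γ => DOcc A B γ)).filter (fun γ => B (U \ γ))).card := by
    apply Finset.card_le_card_of_injOn (fun γ => γ ∪ W₁)
    · intro γ hγ
      rw [Finset.mem_coe, Finset.mem_filter, Finset.mem_filter, Finset.mem_powerset] at hγ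
      obtain ⟨⟨hU, hAγ, hBρ⟩, hDD⟩ := hγ
      have hW : W₁ ∪ W₂ ⊆ U \ γ := hgen (U \ γ) Finset.sdiff_subset hDD
      have hW₁ : W₁ ⊆ U \ γ := Finset.union_subset_left hW
      have hW₂ : W₂ ⊆ U \ γ := Finset.union_subset_right hW
      rw [Finset.mem_coe, Finset.mem_filter, Finset.mem_filter, Finset.mem_powerset]
      refine ⟨⟨Finset.union_subset hU (hW₁.trans Finset.sdiff_subset), ?_⟩, ?_⟩
      · -- `A □ B` at `γ ∪ W₁`: witnesses `γ` (for `A`) and `W₁` (for `B`)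
        refine ⟨γ, W₁, Finset.subset_union_left, Finset.subset_union_right, ?_, ?_, ?_⟩
        · rw [Finset.disjoint_left]
          intro x hxγ hxW
          exact (Finset.mem_sdiff.mp (hW₁ hxW)).2 hxγ
        · exact fun T hT => hA hT hAγ
        · exact fun T hT => hB hT h₁
      · -- the new red side contains `W₂`
        apply hB _ h₂
        intro x hx
        rw [Finset.mem_sdiff, Finset.mem_union]
        refine ⟨(Finset.mem_sdiff.mp (hW₂ hx)).1, ?_⟩
        rintro (hxγ | hxW)
        · exact (Finset.mem_sdiff.mp (hW₂ hx)).2 hxγ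
        · exact Finset.disjoint_left.mp hd hxW hx
    · intro γ hγ γ' hγ' h
      rw [Finset.mem_coe, Finset.mem_filter, Finset.mem_filter, Finset.mem_powerset] at hγ hγ'
      have e : ∀ δ, δ ⊆ U → DOcc B B (U \ δ) → (δ ∪ W₁) \ W₁ = δ := by
        intro δ hδU hδ
        have hW₁ : W₁ ⊆ U \ δ := Finset.union_subset_left (hgen (U \ δ) Finset.sdiff_subset hδ)
        apply Finset.union_sdiff_cancel_right
        rw [Finset.disjoint_left]
        intro x hxδ hxW
        exact (Finset.mem_sdiff.mp (hW₁ hxW)).2 hxδ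
      simp only at h
      rw [← e γ hγ.1.1 hγ.2, ← e γ' hγ'.1.1 hγ'.2, h]
  -- the targets of (AS3) are Reimer's right side minus the subtracted part, the sources are
  -- Reimer's left side minus the subtracted part
  have c1 : (U.powerset.filter (fun γ => DOcc A B γ ∧ ¬ B (U \ γ))).card
      ≤ ((U.powerset.filter (fun γ => DOcc A B γ)).filter (fun γ => ¬ B (U \ γ))).card := by
    apply Finset.card_le_card
    intro γ hγ
    rw [Finset.mem_filter] at hγ
    rw [Finset.mem_filter, Finset.mem_filter]
    exact ⟨⟨hγ.1, hγ.2.1⟩, hγ.2.2⟩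
  have c2 : ((U.powerset.filter (fun γ => A γ ∧ B (U \ γ))).filter
        (fun γ => ¬ DOcc B B (U \ γ))).card
      ≤ (U.powerset.filter (fun γ => A γ ∧ B (U \ γ) ∧ ¬ DOcc B B (U \ γ))).card := by
    apply Finset.card_le_card
    intro γ hγ
    rw [Finset.mem_filter, Finset.mem_filter] at hγ
    rw [Finset.mem_filter]
    exact ⟨hγ.1.1, hγ.1.2.1, hγ.1.2.2, hγ.2⟩
  omega

/-- **(AS3) for a family of generators with exactly one disjoint pair** `W₁`, `W₂` (all other pairs of
generators meet): `B □ B` is then generated by `W₁ ∪ W₂`. -/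
theorem AS3_of_unique_disjoint_pair (U : Finset E) (A : Finset E → Prop) (hA : Incr A)
    (𝒲 : Finset (Finset E)) (W₁ W₂ : Finset E) (h₁ : W₁ ∈ 𝒲) (h₂ : W₂ ∈ 𝒲) (hd : Disjoint W₁ W₂)
    (huniq : ∀ V ∈ 𝒲, ∀ V' ∈ 𝒲, Disjoint V V' → (V = W₁ ∧ V' = W₂) ∨ (V = W₂ ∧ V' = W₁)) :
    AS3 U A (genBy 𝒲) := by
  apply AS3_of_dOcc_principal U A (genBy 𝒲) hA (incr_genBy 𝒲) W₁ W₂ ⟨W₁, h₁, le_rfl⟩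
    ⟨W₂, h₂, le_rfl⟩ hd
  intro X _ hX
  obtain ⟨K, L, hK, hL, hKL, hAK, hBL⟩ := hX
  obtain ⟨V, hV, hVK⟩ := hAK K le_rfl
  obtain ⟨V', hV', hV'L⟩ := hBL L le_rfl
  have hVV' : Disjoint V V' := Finset.disjoint_of_subset_left hVK (Finset.disjoint_of_subset_right hV'L hKL)
  rcases huniq V hV V' hV' hVV' with ⟨rfl, rfl⟩ | ⟨rfl, rfl⟩
  · exact Finset.union_subset (hVK.trans hK) (hV'L.trans hL)
  · exact Finset.union_subset (hV'L.trans hL) (hVK.trans hK)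

end StepZero

end Summit.Ventures.PercRepro2
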